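import Summits.KontsevichZagierPeriods.KontsevichZagierPeriods.Theses.InequalityCost

/-!
# Crux `InequalityCost.TameCovLimit` (stmt-KontsevichZagierPeriods-8987) — line `reparam` (`Lines/reparam.lean`)

Alternative skeleton registered by the crux-strategist (unit `cstrat-stmt-KontsevichZagierPeriods-8987-s2`) NEXT TO
the live registrar skeleton `Lines/birth.lean` (untouched). Five named stubs and the kernel-checked composition
`TameCovLimit_of : TameCovLimit` (uses the stubs BY NAME; `sorry` only inside `stub_*`). Two stubs are shared
VERBATIM with line `birth` (`stub_pointwiseLimit`, `stub_aeCovAssembly`, identical signatures: one proof serves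
both lines); the three new stubs replace `birth`'s single hardest stub `stub_goodLocus`.

## The line: C²-REPARAMETRISE THE GRAPH OF THE FAMILY, SO THAT BOTH CHANGE-OF-VARIABLES LEGS HAVE BOUNDED C² NORMS

Write `φ_t = Φ(·,t)`, `S_t`, `S'_t = φ_t(S_t)`, `g_t = 1_{S_t} G(·,t)`, `g'_t = 1_{S'_t} G'(·,t)`. The degeneration
of `φ_t` as `t → 0⁺` (Jacobian → 0 or → ∞, folding) is the content of the crux. The lever: do NOT take the standard
part of `φ_t`; take the standard part of a BOUNDED-DERIVATIVE PARAMETRISATION OF ITS GRAPH.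

1. `stub_c2GraphCharts` (size L; the import). The graphs `Γ_t = {(x, φ_t x) : x ∈ S_t} ⊆ [-N,N]^{2n}` form a
   definable family of `≤ n`-dimensional sets; the o-minimal `r`-parametrisation theorem UNIFORM IN PARAMETERS
   (Pila–Wilkie 2006 Thm 2.3/Cor 5.2, Yomdin–Gromov; IN TREE: `Literature.ModelTheory.ExponentialFields.familyParam`
   with `uniformReparam` discharging its `UR(r, ℓ)` hypothesis, `r = 2`) gives finitely many definable families of
   `C²` charts `γ_{j,t} : (0,1)ⁿ → Γ_t` with `‖D^q γ‖ ≤ 1` (`q ≤ 2`) covering `Γ_t`; charts of dimension `< n` have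
   null shadows; placing the `K` top-dimensional charts active near `0⁺` on disjoint diagonal cubes
   `(2k, 2k+1)ⁿ` and selecting one preimage per point (definable choice) yields ONE real-semialgebraic domain family
   `D_t` and two LEGS `ψ_t := p₁ ∘ γ_t : cubes → S_t`, `ψ'_t := p₂ ∘ γ_t = φ_t ∘ ψ_t : cubes → S'_t`, both `C²`-bounded
   (derivative norm `≤ C`, `C`-Lipschitz derivative, `|det| ≤ C`), injective on `D_t`, with co-null images, and —
   by the chain rule for `HasFDerivWithinAt φ_t L S_t` composed with the chart — ONE tame cube integrand
   `h_t = G_t ∘ ψ_t · |det Dψ_t| = G'_t ∘ ψ'_t · |det Dψ'_t|` on `D_t`. Real parameters are allowed here (the tree's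
   `familyParam` is stated for definability with parameters); they are removed in step 4.
2. `stub_pointwiseLimit` (size M, shared with `birth`): the `L¹`-endpoints `r₀`, `r₀'` are the pointwise o-minimal
   limits `g₀`, `g₀'` (ℚ-semialgebraic, bounded).
3. `stub_boundedGoodLocus` (size L→M; classical analysis + three small o-minimal facts). Because the legs are
   `C²`-BOUNDED, their standard parts are free: every derivative entry `t ↦ ∂_i ψ_t^c(u)` is a bounded definable
   function of `t`, hence converges (o-minimality), and equi-Lipschitz families converging pointwise converge
   locally uniformly (tree `tendstoLocallyUniformlyOn_of_lipschitzOnWith`), so `ψ_t → ψ₀`, `Dψ_t → Dψ₀` locally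
   uniformly on the cubes and `ψ₀ ∈ C¹` (Mathlib `hasFDerivAt_of_tendstoLocallyUniformlyOn`); no "generic
   C¹-limit of definable families" (birth's TameC1Limit) and no unbounded Jacobian ever occur. Good locus
   `U ⊆ {h₀ ≠ 0}` (generic, open): `det Dψ₀ ≠ 0` there since `|G| ≤ N`; `ψ₀`, `ψ₀'` injective on `U` by the
   quantitative inverse function theorem (Mathlib `ApproximatesLinearOn.surjOn_closedBall_of_nonlinearRightInverse`)
   against `InjOn ψ_t D_t`; `g₀ = 0` a.e. off `ψ₀(U)` by tracking `u_t = ψ_t⁻¹(x) → u*` plus Sard for `ψ₀`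
   (Mathlib `addHaar_image_eq_zero_of_det_fderivWithin_eq_zero`) plus generic joint continuity of bounded definable
   families at `t = 0⁺`; the a.e. identity `g₀ ∘ ψ₀ · |det Dψ₀| = h₀ = g₀' ∘ ψ₀' · |det Dψ₀'|` on `U`. Output: the
   a.e.-change-of-variables configuration `(V, χ, χ') := (ψ₀(U), ψ₀' ∘ ψ₀⁻¹, D)` between `g₀` and `g₀'`, over `ℝ`.
4. `stub_realConfigDescent` (size M; the landed `DefinableMoves.CovTransfer_proof` is the template: `exists_rat_family`,
   `definable_clause₁–₆`, `exists_mem_isSemialgebraic_singleton`, `AlgebraicPoints/AlgebraicCoefficients`,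
   `NullIffEmptyInterior`): the set of real parameter values for which the configuration clauses hold is
   ℚ-definable (openness, ε-δ derivative, injectivity, `det ≠ 0`, and the three a.e. clauses via
   null ⟺ empty interior) and non-empty, so it has a real-algebraic point: a configuration over `ℚ` exists.
5. `stub_aeCovAssembly` (size M, shared with `birth`): a ℚ-configuration is ONE honest instance of
   `KZ.changeOfVariablesRel` flanked by a.e.-congruences: `KZ.Equivalent r₀ r₀'`.

Composition (`TameCovLimit_of`): stubs 2 (twice), 1, 3, 4, 5 in this order; pure logic, no `sorry` of its own.

Disproof used: none exists for this crux (`ledger crux ls`: only `Lines/birth.*`; no `Disproof.lean`, no `Negative/`).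
Dead lines: none recorded. Why it dodges birth's hardest goal: birth's `stub_goodLocus` must prove a.e. convergence
`∂φ_t → ∂φ₀` for a definable family with NO derivative bounds and must control expansion (`|det ∂φ_t| → ∞`); here
both are designed away by reparametrising the graph (in-tree theorem) — the remaining analysis is on equi-C² legs.
-/

set_option linter.dupNamespace false

noncomputable section

open MeasureTheory Set Filter
open scoped Topology

namespace Summit.KontsevichZagierPeriods.KontsevichZagierPeriods.Cruxes.TameCovLimit.Reparam

open Literature.NumberTheory.Transcendental Literature.NumberTheory.Transcendental.KZ
open Literature.ModelTheory.ExponentialFields (IsSemialgebraic)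
open Summit.KontsevichZagierPeriods.KontsevichZagierPeriods.Theses.InequalityCost (TameCovLimit)

/-- **STUB `stub_pointwiseLimit` (size M; SHARED VERBATIM with line `birth`) — the `L¹`-endpoint of a tame family
is its pointwise o-minimal limit.** For a tame `ℚ`-semialgebraic family (`S ⊆ [-N,N]ⁿ⁺¹`, `|G| ≤ N` on `S`) the
extended fibre integrands `g_t = 1_{S_t} G(·,t)` converge at EVERY point as `t → 0⁺` to a `ℚ`-semialgebraic `g₀`
with `|g₀| ≤ N`, supported in the box `[-N,N]ⁿ`; and if `g_t → 1_{dom r₀} f₀` in `L¹` then `1_{dom r₀} f₀ = g₀`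
a.e. [van den Dries 1998, Ch. 3 (monotonicity), Ch. 1 §5; tree `OMinimalLimits.tendsto_nhdsGT_or`,
`definableFun_limRight`, `definable_iff_isSemialgebraic_real_holds`; Mathlib dominated convergence] -/
theorem stub_pointwiseLimit :
    ∀ ⦃n : ℕ⦄ (N : ℕ) (S : Set (Fin (n + 1) → ℝ)) (G : (Fin (n + 1) → ℝ) → ℝ)
      (r₀ : Literature.NumberTheory.Transcendental.KZ.IntegralRep n),
      Literature.ModelTheory.ExponentialFields.IsSemialgebraic ℚ S →
      Literature.NumberTheory.Transcendental.IsSemialgebraicFunOn ℚ S G →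
      (∀ z ∈ S, (∀ i, |z i| ≤ N) ∧ |G z| ≤ N) →
      Filter.Tendsto (fun t : ℝ => ∫ x : Fin n → ℝ,
          |{x : Fin n → ℝ | Fin.snoc x t ∈ S}.indicator (fun x => G (Fin.snoc x t)) x
            - r₀.domain.indicator r₀.integrand x|) (𝓝[>] (0:ℝ)) (𝓝 0) →
      ∃ g₀ : (Fin n → ℝ) → ℝ,
        Literature.NumberTheory.Transcendental.IsSemialgebraicFunOn ℚ Set.univ g₀ ∧
        (∀ x, |g₀ x| ≤ N) ∧ (∀ x, g₀ x ≠ 0 → ∀ i, |x i| ≤ N) ∧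
        (∀ x : Fin n → ℝ, Filter.Tendsto
            (fun t : ℝ => {x : Fin n → ℝ | Fin.snoc x t ∈ S}.indicator (fun x => G (Fin.snoc x t)) x)
            (𝓝[>] (0:ℝ)) (𝓝 (g₀ x))) ∧
        r₀.domain.indicator r₀.integrand =ᵐ[MeasureTheory.volume] g₀ := by
  sorry

/-- **STUB `stub_c2GraphCharts` (size L; the reparametrisation import) — a tame change-of-variables family factors,
near `t = 0⁺`, through ONE cube family with two `C²`-bounded legs.** For the tame `ℚ`-semialgebraic family of rule-2
instances of the crux there are `K` (number of top-dimensional charts), a constant `C`, a threshold `δ ∈ (0,1]`,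
a real-semialgebraic total domain `D ⊆ (cubes) × (0,δ)` (cubes = the disjoint diagonal unit cubes `(2k,2k+1)ⁿ`,
`k < K`) and real-semialgebraic leg maps `ψ, ψ'` with derivative families `Dψ, Dψ'` (real-semialgebraic entries)
such that for every `t ∈ (0,δ)`: on the cubes both legs are differentiable with `‖D‖ ≤ C`, `|det D| ≤ C` and
`C`-Lipschitz derivatives cube by cube, `ψ_t` maps the cubes into `S_t` and `ψ'_t = φ_t ∘ ψ_t` maps them into
`S'_t`; on `D_t` both legs are injective with co-null images in `S_t`, `S'_t`; and the two pulled-back integrands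
agree: `G_t(ψ_t u)|det Dψ_t u| = G'_t(ψ'_t u)|det Dψ'_t u|` for `u ∈ D_t`. Proof plan: `familyParam` (with
`uniformReparam`, `real_isOMinimal_holds`, `r = 2`) applied to the affinely rescaled graph family
`{(t, x, φ_t x)} ⊆ ℝ × (0,1)^{2n}`; keep the charts of dimension `n` active on a final segment `(0,δ)` (activity is
definable in `t`, hence eventually constant); legs = coordinate projections of the charts; derivative bounds from
`‖iteratedFDeriv‖ ≤ 1` and the mean value inequality; lower-dimensional charts and the multiple-preimage locus have
lower-dimensional (null) shadows (o-minimal dimension theory, `volume` of a semialgebraic set of empty interior is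
`0`); injectivity by definable choice of one preimage; the integrand identity by the chain rule
(`HasFDerivWithinAt.comp` with `MapsTo ψ_t cube S_t`, uniqueness of `fderiv` on the open cube, `det` multiplicative).
[Pila–Wilkie 2006, Thm 2.3 / §5 (II)_m, Cor. 5.2; Bhardwaj–van den Dries 2022, Thm 4.3; Gromov 1987 / Yomdin 1987;
tree `familyParam`, `uniformReparam`, `OMinimalDefinableChoice`, `OMinimalDimension*`] -/
theorem stub_c2GraphCharts :
    ∀ ⦃n : ℕ⦄ (N : ℕ) (S S' : Set (Fin (n + 1) → ℝ)) (G G' : (Fin (n + 1) → ℝ) → ℝ)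
      (Φ : (Fin (n + 1) → ℝ) → (Fin n → ℝ)),
      Literature.ModelTheory.ExponentialFields.IsSemialgebraic ℚ S →
      Literature.NumberTheory.Transcendental.IsSemialgebraicFunOn ℚ S G →
      Literature.ModelTheory.ExponentialFields.IsSemialgebraic ℚ S' →
      Literature.NumberTheory.Transcendental.IsSemialgebraicFunOn ℚ S' G' →
      Literature.NumberTheory.Transcendental.IsSemialgebraicMapOn ℚ S Φ →
      (∀ z ∈ S, (∀ i, |z i| ≤ N) ∧ |G z| ≤ N) → (∀ z ∈ S', (∀ i, |z i| ≤ N) ∧ |G' z| ≤ N) →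
      (∀ t ∈ Set.Ioo (0:ℝ) 1,
        Set.InjOn (fun x : Fin n → ℝ => Φ (Fin.snoc x t)) {x | Fin.snoc x t ∈ S} ∧
        (fun x : Fin n → ℝ => Φ (Fin.snoc x t)) '' {x | Fin.snoc x t ∈ S} = {y | Fin.snoc y t ∈ S'} ∧
        ∀ x : Fin n → ℝ, Fin.snoc x t ∈ S → ∃ L : (Fin n → ℝ) →L[ℝ] (Fin n → ℝ),
          HasFDerivWithinAt (fun x : Fin n → ℝ => Φ (Fin.snoc x t)) L {x | Fin.snoc x t ∈ S} x ∧
          G (Fin.snoc x t) = G' (Fin.snoc (Φ (Fin.snoc x t)) t) * |L.det|) →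
      ∃ (K : ℕ) (C δ : ℝ) (D : Set (Fin (n + 1) → ℝ)) (ψ ψ' : (Fin (n + 1) → ℝ) → (Fin n → ℝ))
        (Dψ Dψ' : (Fin (n + 1) → ℝ) → (Fin n → ℝ) →L[ℝ] (Fin n → ℝ)),
        (0 < δ ∧ δ ≤ 1) ∧
        Literature.ModelTheory.ExponentialFields.IsSemialgebraic ℝ D ∧
        (∀ z ∈ D, (∃ k : ℕ, k < K ∧ ∀ i, 2 * (k : ℝ) < Fin.init z i ∧ Fin.init z i < 2 * (k : ℝ) + 1) ∧
          z (Fin.last n) ∈ Set.Ioo (0:ℝ) δ) ∧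
        (Literature.NumberTheory.Transcendental.IsSemialgebraicMapOn ℝ
            {z : Fin (n + 1) → ℝ | (∃ k : ℕ, k < K ∧ ∀ i, 2 * (k : ℝ) < Fin.init z i ∧
              Fin.init z i < 2 * (k : ℝ) + 1) ∧ z (Fin.last n) ∈ Set.Ioo (0:ℝ) δ} ψ ∧
          Literature.NumberTheory.Transcendental.IsSemialgebraicMapOn ℝ
            {z : Fin (n + 1) → ℝ | (∃ k : ℕ, k < K ∧ ∀ i, 2 * (k : ℝ) < Fin.init z i ∧
              Fin.init z i < 2 * (k : ℝ) + 1) ∧ z (Fin.last n) ∈ Set.Ioo (0:ℝ) δ} ψ') ∧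
        (∀ i j : Fin n,
          Literature.NumberTheory.Transcendental.IsSemialgebraicFunOn ℝ
            {z : Fin (n + 1) → ℝ | (∃ k : ℕ, k < K ∧ ∀ i, 2 * (k : ℝ) < Fin.init z i ∧
              Fin.init z i < 2 * (k : ℝ) + 1) ∧ z (Fin.last n) ∈ Set.Ioo (0:ℝ) δ}
            (fun z => (Dψ z) (Pi.single j (1:ℝ)) i) ∧
          Literature.NumberTheory.Transcendental.IsSemialgebraicFunOn ℝ
            {z : Fin (n + 1) → ℝ | (∃ k : ℕ, k < K ∧ ∀ i, 2 * (k : ℝ) < Fin.init z i ∧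
              Fin.init z i < 2 * (k : ℝ) + 1) ∧ z (Fin.last n) ∈ Set.Ioo (0:ℝ) δ}
            (fun z => (Dψ' z) (Pi.single j (1:ℝ)) i)) ∧
        (∀ t ∈ Set.Ioo (0:ℝ) δ, ∀ u : Fin n → ℝ,
          (∃ k : ℕ, k < K ∧ ∀ i, 2 * (k : ℝ) < u i ∧ u i < 2 * (k : ℝ) + 1) →
          HasFDerivAt (fun v : Fin n → ℝ => ψ (Fin.snoc v t)) (Dψ (Fin.snoc u t)) u ∧
          HasFDerivAt (fun v : Fin n → ℝ => ψ' (Fin.snoc v t)) (Dψ' (Fin.snoc u t)) u ∧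
          ‖Dψ (Fin.snoc u t)‖ ≤ C ∧ ‖Dψ' (Fin.snoc u t)‖ ≤ C ∧
          |(Dψ (Fin.snoc u t)).det| ≤ C ∧ |(Dψ' (Fin.snoc u t)).det| ≤ C ∧
          Fin.snoc (ψ (Fin.snoc u t)) t ∈ S ∧ Fin.snoc (ψ' (Fin.snoc u t)) t ∈ S' ∧
          ψ' (Fin.snoc u t) = Φ (Fin.snoc (ψ (Fin.snoc u t)) t)) ∧
        (∀ t ∈ Set.Ioo (0:ℝ) δ, ∀ k : ℕ, k < K → ∀ u v : Fin n → ℝ,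
          (∀ i, 2 * (k : ℝ) < u i ∧ u i < 2 * (k : ℝ) + 1) → (∀ i, 2 * (k : ℝ) < v i ∧ v i < 2 * (k : ℝ) + 1) →
          ‖Dψ (Fin.snoc u t) - Dψ (Fin.snoc v t)‖ ≤ C * ‖u - v‖ ∧
          ‖Dψ' (Fin.snoc u t) - Dψ' (Fin.snoc v t)‖ ≤ C * ‖u - v‖) ∧
        (∀ t ∈ Set.Ioo (0:ℝ) δ,
          Set.InjOn (fun u : Fin n → ℝ => ψ (Fin.snoc u t)) {u | Fin.snoc u t ∈ D} ∧
          Set.InjOn (fun u : Fin n → ℝ => ψ' (Fin.snoc u t)) {u | Fin.snoc u t ∈ D} ∧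
          MeasureTheory.volume ({x : Fin n → ℝ | Fin.snoc x t ∈ S} \
            (fun u : Fin n → ℝ => ψ (Fin.snoc u t)) '' {u | Fin.snoc u t ∈ D}) = 0 ∧
          MeasureTheory.volume ({y : Fin n → ℝ | Fin.snoc y t ∈ S'} \
            (fun u : Fin n → ℝ => ψ' (Fin.snoc u t)) '' {u | Fin.snoc u t ∈ D}) = 0) ∧
        (∀ t ∈ Set.Ioo (0:ℝ) δ, ∀ u : Fin n → ℝ, Fin.snoc u t ∈ D →
          G (Fin.snoc (ψ (Fin.snoc u t)) t) * |(Dψ (Fin.snoc u t)).det| =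
            G' (Fin.snoc (ψ' (Fin.snoc u t)) t) * |(Dψ' (Fin.snoc u t)).det|) := by
  sorry

/-- **STUB `stub_boundedGoodLocus` (HARDEST, size L→M) — standard part of a cube family with two `C²`-bounded
legs: the a.e.-change-of-variables configuration between the two pointwise limits, over `ℝ`.** Given the tame
`ℚ`-semialgebraic families `(S,G)`, `(S',G')` with pointwise limits `g₀`, `g₀'` of their extended fibre
integrands, and the package of `stub_c2GraphCharts` (cube domain family `D`, legs `ψ, ψ'` with real-semialgebraic
derivative families, `C²` bounds, injectivity on `D_t`, co-null images, pulled-back integrand identity), there is an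
OPEN real-semialgebraic `V ⊆ ℝⁿ`, a real-semialgebraic `χ` on `V` with derivative family `χ'` whose matrix entries
are real-semialgebraic, differentiable and injective on `V` with `det χ' ≠ 0`, such that `g₀ = 0` a.e. off `V`,
`g₀' = 0` a.e. off `χ '' V`, and `g₀ = g₀' ∘ χ · |det χ'|` a.e. on `V`. Proof plan: (i) `ψ_t → ψ₀`, `Dψ_t → Dψ₀`
locally uniformly on the cubes (every derivative entry is a bounded real-definable function of `t`:
`exists_tendsto_nhdsGT_of_bounded` / `OMinimalLimits.tendsto_nhdsGT_or` with `real_isOMinimal_holds`; equi-Lipschitz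
⇒ locally uniform: `tendstoLocallyUniformlyOn_of_lipschitzOnWith`; `hasFDerivAt_of_tendstoLocallyUniformlyOn`);
same for `ψ'`; (ii) `h_t u := 1_{D_t}(u) G_t(ψ_t u)|det Dψ_t u|` is bounded real-definable, pointwise limit `h₀`;
`E := {h₀ ≠ 0}` has `det Dψ₀ ≠ 0`, `det Dψ₀' ≠ 0` (as `|G|,|G'| ≤ N`); `U :=` the open generic part of `E` where the
eventual-membership modulus `τ(u) = sup {s | ∀ t < s, u ∈ D_t}` is locally bounded below (continuity points of a
definable function are generic); (iii) `ψ₀`, `ψ₀'` injective on `U`: two preimages give, by the quantitative inverse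
function theorem under uniform `C²` control (`ApproximatesLinearOn.surjOn_closedBall_of_nonlinearRightInverse`),
overlapping images `ψ_t(B(u₁,r)) ∩ ψ_t(B(u₂,r)) ≠ ∅` for small `t`, contradicting `InjOn ψ_t D_t`; (iv) for a.e.
`x` with `g₀ x ≠ 0`: `x = ψ_t(u_t)`, `u_t ∈ D_t` (co-null images; Fubini in `(x,t)`), `u_t → u*` (definable),
`h_t(u_t) = G_t(x)|det Dψ_t(u_t)| → g₀(x)|det Dψ₀(u*)|`, Sard for `ψ₀`
(`MeasureTheory.addHaar_image_eq_zero_of_det_fderivWithin_eq_zero`) and generic joint continuity of bounded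
definable families at `0⁺` (o-minimal: oscillation and modulus are definable) give `u* ∈ U`, i.e. `x ∈ ψ₀(U)`;
symmetrically for `g₀'`; (v) on `U`, `g₀(ψ₀ u)|det Dψ₀ u| = h₀ u = g₀'(ψ₀' u)|det Dψ₀' u|` a.e. (joint
continuity of `g`, `g'` at generic points, `ψ₀⁻¹(null) ∩ U` null); (vi) `V := ψ₀ '' U`,
`χ := ψ₀' ∘ (ψ₀|U)⁻¹`, `χ' := Dψ₀' ∘ (Dψ₀)⁻¹` transported; real-semialgebraic as o-minimal limits / inverses /
derivatives of real-definable maps (`definableFun_limRight`, `definable_iff_isSemialgebraic_real`-type lemmas,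
`SemialgebraicPartialDeriv`). [Pila–Wilkie 2006 §4; Bhardwaj–van den Dries 2022 Lemma 6.1; van den Dries 1998
Ch. 3, Ch. 4 (1.8), Ch. 6; Mathlib inverse function theorem / Sard-type lemma `addHaar_image_eq_zero_of_det_fderivWithin_eq_zero`] -/
theorem stub_boundedGoodLocus :
    ∀ ⦃n : ℕ⦄ (N : ℕ) (S S' : Set (Fin (n + 1) → ℝ)) (G G' : (Fin (n + 1) → ℝ) → ℝ)
      (Φ : (Fin (n + 1) → ℝ) → (Fin n → ℝ)) (K : ℕ) (C δ : ℝ) (D : Set (Fin (n + 1) → ℝ))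
      (ψ ψ' : (Fin (n + 1) → ℝ) → (Fin n → ℝ))
      (Dψ Dψ' : (Fin (n + 1) → ℝ) → (Fin n → ℝ) →L[ℝ] (Fin n → ℝ))
      (g₀ g₀' : (Fin n → ℝ) → ℝ),
      Literature.ModelTheory.ExponentialFields.IsSemialgebraic ℚ S →
      Literature.NumberTheory.Transcendental.IsSemialgebraicFunOn ℚ S G →
      Literature.ModelTheory.ExponentialFields.IsSemialgebraic ℚ S' →
      Literature.NumberTheory.Transcendental.IsSemialgebraicFunOn ℚ S' G' →
      (∀ z ∈ S, (∀ i, |z i| ≤ N) ∧ |G z| ≤ N) → (∀ z ∈ S', (∀ i, |z i| ≤ N) ∧ |G' z| ≤ N) →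
      (0 < δ ∧ δ ≤ 1) →
      Literature.ModelTheory.ExponentialFields.IsSemialgebraic ℝ D →
      (∀ z ∈ D, (∃ k : ℕ, k < K ∧ ∀ i, 2 * (k : ℝ) < Fin.init z i ∧ Fin.init z i < 2 * (k : ℝ) + 1) ∧
        z (Fin.last n) ∈ Set.Ioo (0:ℝ) δ) →
      (Literature.NumberTheory.Transcendental.IsSemialgebraicMapOn ℝ
          {z : Fin (n + 1) → ℝ | (∃ k : ℕ, k < K ∧ ∀ i, 2 * (k : ℝ) < Fin.init z i ∧
            Fin.init z i < 2 * (k : ℝ) + 1) ∧ z (Fin.last n) ∈ Set.Ioo (0:ℝ) δ} ψ ∧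
        Literature.NumberTheory.Transcendental.IsSemialgebraicMapOn ℝ
          {z : Fin (n + 1) → ℝ | (∃ k : ℕ, k < K ∧ ∀ i, 2 * (k : ℝ) < Fin.init z i ∧
            Fin.init z i < 2 * (k : ℝ) + 1) ∧ z (Fin.last n) ∈ Set.Ioo (0:ℝ) δ} ψ') →
      (∀ i j : Fin n,
        Literature.NumberTheory.Transcendental.IsSemialgebraicFunOn ℝ
          {z : Fin (n + 1) → ℝ | (∃ k : ℕ, k < K ∧ ∀ i, 2 * (k : ℝ) < Fin.init z i ∧
            Fin.init z i < 2 * (k : ℝ) + 1) ∧ z (Fin.last n) ∈ Set.Ioo (0:ℝ) δ}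
          (fun z => (Dψ z) (Pi.single j (1:ℝ)) i) ∧
        Literature.NumberTheory.Transcendental.IsSemialgebraicFunOn ℝ
          {z : Fin (n + 1) → ℝ | (∃ k : ℕ, k < K ∧ ∀ i, 2 * (k : ℝ) < Fin.init z i ∧
            Fin.init z i < 2 * (k : ℝ) + 1) ∧ z (Fin.last n) ∈ Set.Ioo (0:ℝ) δ}
          (fun z => (Dψ' z) (Pi.single j (1:ℝ)) i)) →
      (∀ t ∈ Set.Ioo (0:ℝ) δ, ∀ u : Fin n → ℝ,
        (∃ k : ℕ, k < K ∧ ∀ i, 2 * (k : ℝ) < u i ∧ u i < 2 * (k : ℝ) + 1) →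
        HasFDerivAt (fun v : Fin n → ℝ => ψ (Fin.snoc v t)) (Dψ (Fin.snoc u t)) u ∧
        HasFDerivAt (fun v : Fin n → ℝ => ψ' (Fin.snoc v t)) (Dψ' (Fin.snoc u t)) u ∧
        ‖Dψ (Fin.snoc u t)‖ ≤ C ∧ ‖Dψ' (Fin.snoc u t)‖ ≤ C ∧
        |(Dψ (Fin.snoc u t)).det| ≤ C ∧ |(Dψ' (Fin.snoc u t)).det| ≤ C ∧
        Fin.snoc (ψ (Fin.snoc u t)) t ∈ S ∧ Fin.snoc (ψ' (Fin.snoc u t)) t ∈ S' ∧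
        ψ' (Fin.snoc u t) = Φ (Fin.snoc (ψ (Fin.snoc u t)) t)) →
      (∀ t ∈ Set.Ioo (0:ℝ) δ, ∀ k : ℕ, k < K → ∀ u v : Fin n → ℝ,
        (∀ i, 2 * (k : ℝ) < u i ∧ u i < 2 * (k : ℝ) + 1) → (∀ i, 2 * (k : ℝ) < v i ∧ v i < 2 * (k : ℝ) + 1) →
        ‖Dψ (Fin.snoc u t) - Dψ (Fin.snoc v t)‖ ≤ C * ‖u - v‖ ∧
        ‖Dψ' (Fin.snoc u t) - Dψ' (Fin.snoc v t)‖ ≤ C * ‖u - v‖) →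
      (∀ t ∈ Set.Ioo (0:ℝ) δ,
        Set.InjOn (fun u : Fin n → ℝ => ψ (Fin.snoc u t)) {u | Fin.snoc u t ∈ D} ∧
        Set.InjOn (fun u : Fin n → ℝ => ψ' (Fin.snoc u t)) {u | Fin.snoc u t ∈ D} ∧
        MeasureTheory.volume ({x : Fin n → ℝ | Fin.snoc x t ∈ S} \
          (fun u : Fin n → ℝ => ψ (Fin.snoc u t)) '' {u | Fin.snoc u t ∈ D}) = 0 ∧
        MeasureTheory.volume ({y : Fin n → ℝ | Fin.snoc y t ∈ S'} \
          (fun u : Fin n → ℝ => ψ' (Fin.snoc u t)) '' {u | Fin.snoc u t ∈ D}) = 0) →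
      (∀ t ∈ Set.Ioo (0:ℝ) δ, ∀ u : Fin n → ℝ, Fin.snoc u t ∈ D →
        G (Fin.snoc (ψ (Fin.snoc u t)) t) * |(Dψ (Fin.snoc u t)).det| =
          G' (Fin.snoc (ψ' (Fin.snoc u t)) t) * |(Dψ' (Fin.snoc u t)).det|) →
      (∀ x : Fin n → ℝ, Filter.Tendsto
          (fun t : ℝ => {x : Fin n → ℝ | Fin.snoc x t ∈ S}.indicator (fun x => G (Fin.snoc x t)) x)
          (𝓝[>] (0:ℝ)) (𝓝 (g₀ x))) →
      (∀ y : Fin n → ℝ, Filter.Tendsto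
          (fun t : ℝ => {y : Fin n → ℝ | Fin.snoc y t ∈ S'}.indicator (fun y => G' (Fin.snoc y t)) y)
          (𝓝[>] (0:ℝ)) (𝓝 (g₀' y))) →
      ∃ (V : Set (Fin n → ℝ)) (χ : (Fin n → ℝ) → (Fin n → ℝ))
        (χ' : (Fin n → ℝ) → (Fin n → ℝ) →L[ℝ] (Fin n → ℝ)),
        IsOpen V ∧ Literature.ModelTheory.ExponentialFields.IsSemialgebraic ℝ V ∧
        Literature.NumberTheory.Transcendental.IsSemialgebraicMapOn ℝ V χ ∧
        (∀ i j : Fin n, Literature.NumberTheory.Transcendental.IsSemialgebraicFunOn ℝ V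
          (fun x => (χ' x) (Pi.single j (1:ℝ)) i)) ∧
        (∀ x ∈ V, HasFDerivAt χ (χ' x) x) ∧ Set.InjOn χ V ∧ (∀ x ∈ V, (χ' x).det ≠ 0) ∧
        (∀ᵐ x ∂MeasureTheory.volume, x ∉ V → g₀ x = 0) ∧
        (∀ᵐ y ∂MeasureTheory.volume, y ∉ χ '' V → g₀' y = 0) ∧
        (∀ᵐ x ∂MeasureTheory.volume, x ∈ V → g₀ x = g₀' (χ x) * |(χ' x).det|) := by
  sorry

/-- **STUB `stub_realConfigDescent` (size M; Tarski-transfer bookkeeping, template = landed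
`DefinableMoves.CovTransfer_proof`) — an a.e.-change-of-variables configuration over `ℝ` between two
`ℚ`-semialgebraic functions descends to one over `ℚ`.** If `g₀, g₀'` are `ℚ`-semialgebraic on `ℝⁿ` and there
are an open real-semialgebraic `V`, a real-semialgebraic `χ` with derivative family `χ'` (real-semialgebraic matrix
entries), differentiable and injective on `V` with `det χ' ≠ 0`, such that `g₀ = 0` a.e. off `V`, `g₀' = 0` a.e.
off `χ '' V` and `g₀ = g₀' ∘ χ · |det χ'|` a.e. on `V`, then the same holds for some `ℚ`-semialgebraic `(U, ξ, ξ')`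
(with `ℚ`-semialgebraic Jacobian determinant). Proof plan: `(V, χ, χ')` is the fibre at a real parameter `d₀` of a
`ℚ`-semialgebraic family (`exists_rat_family`); each clause is `ℚ`-definable in the parameter (openness; ε-δ form of
`HasFDerivAt`, cf. `hasFDerivWithinAt_iff_coord` and `definable_clause₁–₆`; injectivity; `det ≠ 0`; the a.e. clauses
because for semialgebraic sets null ⟺ empty interior, cf. `NullIffEmptyInterior`); the parameter set is
`ℚ`-semialgebraic (Tarski–Seidenberg) and non-empty, hence contains `d₁` with `{d₁}` `ℚ`-semialgebraic
(`exists_mem_isSemialgebraic_singleton` / `AlgebraicPoints`), and the fibre at `d₁` is `ℚ`-semialgebraic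
(`AlgebraicCoefficients`). [Basu–Pollack–Roy 2006 §2.5; van den Dries 1998 Ch. 6 (1.2); tree Theorems
`DefinableMovesCovTransfer*.lean`, `DefinableMovesAlgebraicPoints.lean`, `DefinableMovesNullIffEmptyInterior.lean`] -/
theorem stub_realConfigDescent :
    ∀ ⦃n : ℕ⦄ (g₀ g₀' : (Fin n → ℝ) → ℝ) (V : Set (Fin n → ℝ)) (χ : (Fin n → ℝ) → (Fin n → ℝ))
      (χ' : (Fin n → ℝ) → (Fin n → ℝ) →L[ℝ] (Fin n → ℝ)),
      Literature.NumberTheory.Transcendental.IsSemialgebraicFunOn ℚ Set.univ g₀ →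
      Literature.NumberTheory.Transcendental.IsSemialgebraicFunOn ℚ Set.univ g₀' →
      IsOpen V → Literature.ModelTheory.ExponentialFields.IsSemialgebraic ℝ V →
      Literature.NumberTheory.Transcendental.IsSemialgebraicMapOn ℝ V χ →
      (∀ i j : Fin n, Literature.NumberTheory.Transcendental.IsSemialgebraicFunOn ℝ V
        (fun x => (χ' x) (Pi.single j (1:ℝ)) i)) →
      (∀ x ∈ V, HasFDerivAt χ (χ' x) x) → Set.InjOn χ V → (∀ x ∈ V, (χ' x).det ≠ 0) →
      (∀ᵐ x ∂MeasureTheory.volume, x ∉ V → g₀ x = 0) →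
      (∀ᵐ y ∂MeasureTheory.volume, y ∉ χ '' V → g₀' y = 0) →
      (∀ᵐ x ∂MeasureTheory.volume, x ∈ V → g₀ x = g₀' (χ x) * |(χ' x).det|) →
      ∃ (U : Set (Fin n → ℝ)) (ξ : (Fin n → ℝ) → (Fin n → ℝ))
        (ξ' : (Fin n → ℝ) → (Fin n → ℝ) →L[ℝ] (Fin n → ℝ)),
        IsOpen U ∧ Literature.ModelTheory.ExponentialFields.IsSemialgebraic ℚ U ∧
        Literature.NumberTheory.Transcendental.IsSemialgebraicMapOn ℚ U ξ ∧
        Literature.NumberTheory.Transcendental.IsSemialgebraicFunOn ℚ U (fun x => (ξ' x).det) ∧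
        (∀ x ∈ U, HasFDerivAt ξ (ξ' x) x) ∧ Set.InjOn ξ U ∧ (∀ x ∈ U, (ξ' x).det ≠ 0) ∧
        (∀ᵐ x ∂MeasureTheory.volume, x ∉ U → g₀ x = 0) ∧
        (∀ᵐ y ∂MeasureTheory.volume, y ∉ ξ '' U → g₀' y = 0) ∧
        (∀ᵐ x ∂MeasureTheory.volume, x ∈ U → g₀ x = g₀' (ξ x) * |(ξ' x).det|) := by
  sorry

/-- **STUB `stub_aeCovAssembly` (size M; SHARED VERBATIM with line `birth`) — an a.e.-change-of-variables
configuration is a KZ-chain.** If the extended integrands of `r₀`, `r₀'` have representatives `ρ`, `ρ'` and there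
is an open `ℚ`-semialgebraic `U`, a `ℚ`-semialgebraic `ψ` differentiable and injective on `U` with
`ℚ`-semialgebraic non-vanishing Jacobian determinant, such that `ρ = 0` a.e. off `U`, `ρ' = 0` a.e. off `ψ '' U`
and `ρ = ρ' ∘ ψ · |det ψ'|` a.e. on `U`, then `KZ.Equivalent r₀ r₀'` (domain additivity + a.e.-congruence
`SpAeCongruence_proof` to discard null debris; ONE instance of `KZ.changeOfVariablesRel` on `U`).
[Kontsevich–Zagier 2001, §1.2 rule (2); Mathlib `MeasureTheory.integral_image_eq_integral_abs_det_fderiv_smul`] -/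
theorem stub_aeCovAssembly :
    ∀ ⦃n : ℕ⦄ (r₀ r₀' : Literature.NumberTheory.Transcendental.KZ.IntegralRep n)
      (ρ ρ' : (Fin n → ℝ) → ℝ) (U : Set (Fin n → ℝ)) (ψ : (Fin n → ℝ) → (Fin n → ℝ))
      (ψ' : (Fin n → ℝ) → (Fin n → ℝ) →L[ℝ] (Fin n → ℝ)),
      r₀.domain.indicator r₀.integrand =ᵐ[MeasureTheory.volume] ρ →
      r₀'.domain.indicator r₀'.integrand =ᵐ[MeasureTheory.volume] ρ' →
      IsOpen U → Literature.ModelTheory.ExponentialFields.IsSemialgebraic ℚ U →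
      Literature.NumberTheory.Transcendental.IsSemialgebraicMapOn ℚ U ψ →
      Literature.NumberTheory.Transcendental.IsSemialgebraicFunOn ℚ U (fun x => (ψ' x).det) →
      (∀ x ∈ U, HasFDerivAt ψ (ψ' x) x) → Set.InjOn ψ U → (∀ x ∈ U, (ψ' x).det ≠ 0) →
      (∀ᵐ x ∂MeasureTheory.volume, x ∉ U → ρ x = 0) →
      (∀ᵐ y ∂MeasureTheory.volume, y ∉ ψ '' U → ρ' y = 0) →
      (∀ᵐ x ∂MeasureTheory.volume, x ∈ U → ρ x = ρ' (ψ x) * |(ψ' x).det|) →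
      Literature.NumberTheory.Transcendental.KZ.Equivalent r₀ r₀' := by
  sorry

/-! ### Composition (no `sorry` below this line) -/

/-- **Composition (kernel-checked): the crux `TameCovLimit` BY NAME from the five stubs.** Pointwise limits
`g₀, g₀'` of both tame families (`stub_pointwiseLimit`, twice); the `C²`-bounded two-leg factorisation through the
cubes (`stub_c2GraphCharts`); the real a.e.-change-of-variables configuration between `g₀` and `g₀'`
(`stub_boundedGoodLocus`); its descent to `ℚ` (`stub_realConfigDescent`); the chain (`stub_aeCovAssembly`).
Pure logic. [Kontsevich–Zagier 2001, §1.2 rule (2); Pila–Wilkie 2006, Thm 2.3] -/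
theorem TameCovLimit_of : TameCovLimit := by
  intro n N S S' G G' Φ r₀ r₀' hS hG hS' hG' hΦ hb hb' hcov hL hL'
  -- pointwise (o-minimal) limits of both extended fibre integrands, identified with the L¹-endpoints
  obtain ⟨g₀, hg₀, -, -, hg₀t, hg₀ae⟩ := stub_pointwiseLimit N S G r₀ hS hG hb hL
  obtain ⟨g₀', hg₀', -, -, hg₀'t, hg₀'ae⟩ := stub_pointwiseLimit N S' G' r₀' hS' hG' hb' hL'
  -- C²-bounded two-leg factorisation of the family of change-of-variables instances through the cubes
  obtain ⟨K, C, δ, D, ψ, ψ', Dψ, Dψ', p0, p1, p2, p3, p4, p5, p6, p7, p8⟩ :=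
    stub_c2GraphCharts N S S' G G' Φ hS hG hS' hG' hΦ hb hb' hcov
  -- the good locus of the standard parts of the two legs: a real a.e.-CoV configuration between g₀ and g₀'
  obtain ⟨V, χ, χ', hV, hVsa, hχ, hχ', hder, hinj, hdet, hoff, hoff', hcfg⟩ :=
    stub_boundedGoodLocus N S S' G G' Φ K C δ D ψ ψ' Dψ Dψ' g₀ g₀' hS hG hS' hG' hb hb'
      p0 p1 p2 p3 p4 p5 p6 p7 p8 hg₀t hg₀'t
  -- descent of the real parameters of the configuration to ℚ
  obtain ⟨U, ξ, ξ', hU, hUsa, hξ, hξdet, hξder, hξinj, hξdet0, hUoff, hUoff', hUcfg⟩ :=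
    stub_realConfigDescent g₀ g₀' V χ χ' hg₀ hg₀' hV hVsa hχ hχ' hder hinj hdet hoff hoff' hcfg
  -- one honest change-of-variables move on the good locus plus null debris
  exact stub_aeCovAssembly r₀ r₀' g₀ g₀' U ξ ξ' hg₀ae hg₀'ae hU hUsa hξ hξdet hξder hξinj hξdet0
    hUoff hUoff' hUcfg

end Summit.KontsevichZagierPeriods.KontsevichZagierPeriods.Cruxes.TameCovLimit.Reparam

end
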